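import Summits.Ventures.CertifiedManyBodySolver.Observables.PhaseSeparationExclusionBoxThermalDoccAnchorAxes
import Summits.Ventures.CertifiedManyBodySolver.Observables.PhaseSeparationExclusionParticleHole
import HarnessLib

/-!
# Ventures/CertifiedManyBodySolver — Observables/PhaseSeparationExclusionBoxThermalDoccAnchorMirror.lean: the MOTT (local-moment) anchor of the dense partner on the
# MIRRORED (electron-doped) cell — column × threshold form through the particle–hole reflection

HONEST FRAMING: transport device; CONTROL-class competing-order words; conditional on the rows an instance names; nothing about stripes, about which phase is realised, or about
superconductivity; no number of record. Zero compute, no definition, no claim node. The reflected column law of this seat (g28,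
`psT_not_thermal_mix_on_cell_of_columns_hotAnchorSS_tcap_reflected`, `Observables/PhaseSeparationExclusionParticleHoleColumns.lean`: hole-side column data on the source cell
`[s₁, s₂] × [U₁, U₂]` ⇒ the electron-doped word «no (≤ 2 − n₂ ∣ ≥ 2 − n₁) coexistence» on the MIRRORED cell `[−s₂, −s₁] × [U₁, U₂]`) re-issued with the dense partner's anchor of
`Observables/PhaseSeparationExclusionBoxThermalDoccAnchor.lean` (this seat g32: local-moment entropy `log(2+2q) − (n₂ − 2D) log q`, the thermal double occupancy capped by a
LAGGED `T = 0` floor `G_i ≤ e(t,·,U_i − Δ, n₂)` through the `U`-chord): in the anchored inequality `b·Q₂(s) + β_{h,2} b L_i(s)` becomes `b·(C₀ + C₁(L_i(s) − G_i(s)))`.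
Consumers: the electron-doped `T > 0` words of the NCCO / PCCO / LCCO / SLCO boxes (this seat g28 `…ElectronDopedMirror*Thermal*`, hubbard-box-p3's e-doped psBoxT words),
whose hole-side source cells live on the positive image strip `t′ ∈ [0, 3/10]`.

Cell `pub/hubbard-downfold` (MO-S1 ↔ S2 seam «box ↦ one word»; D-0096 (ii)+(iii)), seat `hubbard-downfold-unc-2` (g32).
References: E. H. Lieb, F. Y. Wu, Physica A 321 (2003) 1, §1 eq. (3) [LiebWuPhysicaA2003]; R. B. Israel, *Convexity in the Theory of Lattice Gases* (1979) Thm I.2.4 [Israel1979];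
E. H. Lieb, CMP 31 (1973) 327 §V [Lieb1973]; D. Poulin, M. B. Hastings, PRL 106 (2011) 080403 [PoulinHastings2011]; D. Ruelle, *Statistical Mechanics* (1969) §3.3 [Ruelle1969].
-/

noncomputable section

namespace Summit.Ventures.CertifiedManyBodySolver.Observables

open Literature.MathematicalPhysics.QuantumLattice Literature.MathematicalPhysics.QuantumLattice.ThermodynamicLimit
open Literature.MathematicalPhysics.QuantumLattice.InfVolFermionState Set Filter

/-- **`T > 0` THERMAL PS EXCLUSION, COLUMN × THRESHOLD FORM, MOTT-ANCHORED DENSE PARTNER, ON THE MIRRORED CELL.** Hypotheses EXACTLY as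
`psT_not_thermal_mix_on_cell_of_columns_doccAnchor_tcap` with `0 < n₁` (source cell `[s₁, s₂] × [U₁, U₂]`, lag `Δ`, column laws `L_i`, lagged column laws `G_i ≤ L_i`, dilute
floor and anchor, witness `q`, constants `C₀ ≥ log(2+2q) − n₂ log q`, `C₁ ≥ 2 log q/Δ`, `C₁ ≤ β_{h,2} ≤ β₀ ≤ β`, both column margins `≥ 0`, the Mott-anchored inequalities on both
columns). CONCLUSION: at every `(s, U)` of the MIRRORED cell `[−s₂, −s₁] × [U₁, U₂]` no mixture `λω₁ + (1−λ)ω₂` of translation-invariant states with `0 < ρ(ω₁) ≤ 2 − n₂`,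
`2 − n₁ ≤ ρ(ω₂) < 2` is a canonical thermal torus-limit state at `(β; t, s, U; n)`, any `0 < n < 2` — same threshold `β₀` as on the source cell.
[cite: LiebWuPhysicaA2003, §1 eq. (3)] [cite: Israel1979, Thm. I.2.4] [cite: Lieb1973, §V (5.2)–(5.4)] [cite: Ruelle1969, §3.3] -/
theorem psT_not_thermal_mix_on_cell_of_columns_doccAnchor_tcap_reflected (t : ℝ)
    {s₁ s₂ U₁ U₂ Δ n₁ n₂ a b c₀ cs c₁ β β₀ βh₁ βh₂ q C₀ C₁ : ℝ}
    (hΔ : 0 < Δ) (hU₁Δ : 0 ≤ U₁ - Δ) (h12 : U₁ < U₂) (hn₁ : 0 < n₁) (hn : n₁ < n₂) (hn₂ : n₂ < 2) (ha : 0 ≤ a) (hb : 0 ≤ b)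
    (hab : a + b = 1) (hβh₁ : 0 ≤ βh₁) (h0₁ : βh₁ ≤ β₀) (hq : 1 < q)
    (hC₀ : Real.log (2 + 2 * q) - Real.log q * n₂ ≤ C₀) (hC₁ : 2 * Real.log q / Δ ≤ C₁) (hβh₂ : C₁ ≤ βh₂) (h0₂ : βh₂ ≤ β₀)
    (hβ₀ : β₀ ≤ β) (hβ₀pos : 0 < β₀) {L₁ L₂ G₁ G₂ F₁ Q₁ : ℝ → ℝ}
    (hC : ∀ s ∈ Icc s₁ s₂, ∀ U ∈ Icc U₁ U₂, energyDensityTT' t s U (a * n₁ + b * n₂) ≤ c₀ + cs * s + c₁ * U)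
    (hL₁ : ∀ s ∈ Icc s₁ s₂, L₁ s ≤ energyDensityTT' t s U₁ n₂) (hL₂ : ∀ s ∈ Icc s₁ s₂, L₂ s ≤ energyDensityTT' t s U₂ n₂)
    (hG₁ : ∀ s ∈ Icc s₁ s₂, G₁ s ≤ energyDensityTT' t s (U₁ - Δ) n₂) (hG₂ : ∀ s ∈ Icc s₁ s₂, G₂ s ≤ energyDensityTT' t s (U₂ - Δ) n₂)
    (hLG₁ : ∀ s ∈ Icc s₁ s₂, G₁ s ≤ L₁ s) (hLG₂ : ∀ s ∈ Icc s₁ s₂, G₂ s ≤ L₂ s)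
    (hF₁ : ∀ s ∈ Icc s₁ s₂, ∀ U ∈ Icc U₁ U₂, F₁ s ≤ energyDensityTT' t s U n₁)
    (hπ₁ : ∀ s ∈ Icc s₁ s₂, ∀ U ∈ Icc U₁ U₂, pressureTT' βh₁ t s U n₁ ≤ Q₁ s)
    (hm₁ : ∀ s ∈ Icc s₁ s₂, 0 ≤ a * F₁ s + b * L₁ s - (c₀ + cs * s + c₁ * U₁))
    (hm₂ : ∀ s ∈ Icc s₁ s₂, 0 ≤ a * F₁ s + b * L₂ s - (c₀ + cs * s + c₁ * U₂))
    (hg₁ : ∀ s ∈ Icc s₁ s₂,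
      a * Q₁ s + βh₁ * (a * F₁ s) + b * (C₀ + C₁ * (L₁ s - G₁ s)) < β₀ * (a * F₁ s + b * L₁ s - (c₀ + cs * s + c₁ * U₁)))
    (hg₂ : ∀ s ∈ Icc s₁ s₂,
      a * Q₁ s + βh₁ * (a * F₁ s) + b * (C₀ + C₁ * (L₂ s - G₂ s)) < β₀ * (a * F₁ s + b * L₂ s - (c₀ + cs * s + c₁ * U₂)))
    {s : ℝ} (hs : s ∈ Icc (-s₂) (-s₁)) {U : ℝ} (hU : U ∈ Icc U₁ U₂)
    {ω₁ ω₂ : InfVolFermionState 2} (h₁ : ω₁.IsTranslationInvariant) (h₂ : ω₂.IsTranslationInvariant)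
    (hρ₁ : 0 < ω₁.density) (hρ₁' : ω₁.density ≤ 2 - n₂) (hρ₂ : 2 - n₁ ≤ ω₂.density) (hρ₂' : ω₂.density < 2)
    {n : ℝ} (hn0 : 0 < n) (hn2 : n < 2) {lam : ℝ} (hl0 : 0 < lam) (hl1 : lam < 1) {Ls : ℕ → ℕ}
    (hLs : Tendsto Ls atTop atTop) :
    ¬ (mix lam hl0.le hl1.le ω₁ ω₂).IsTorusLimitOfMixture (sectorGibbsCount n) (fun L => sectorGibbsWeightTT' β t s U n L)
      (fun L => sectorGibbsVectorTT' t s U n L) Ls := by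
  have hn2' : 0 < n₂ := hn₁.trans hn
  have hU₁ : 0 ≤ U₁ := hU₁Δ.trans (by linarith)
  have hβ0pos : 0 < β := hβ₀pos.trans_le hβ₀
  have hκ : 0 < Real.log q := Real.log_pos hq
  have hC₁pos : 0 < C₁ := lt_of_lt_of_le (div_pos (by linarith) hΔ) hC₁
  have hβh₂' : 0 ≤ βh₂ := hC₁pos.le.trans hβh₂
  refine psT_not_thermal_mix_on_cell_of_fns_hotAnchorFn_reflected t hU₁ hβ0pos hn₁ hn hn₂ ha hb hab hβh₁ hβh₂' (h0₁.trans hβ₀)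
    (h0₂.trans hβ₀) (C := fun s U => c₀ + cs * s + c₁ * U) (F₁ := fun s _ => F₁ s)
    (F₂ := fun s U => ((U₂ - U) * L₁ s + (U - U₁) * L₂ s) / (U₂ - U₁)) (P₁ := fun s _ => Q₁ s)
    (P₂ := fun s U => C₀ + C₁ * (((U₂ - U) * L₁ s + (U - U₁) * L₂ s) / (U₂ - U₁) - ((U₂ - U) * G₁ s + (U - U₁) * G₂ s) / (U₂ - U₁)) -
      βh₂ * (((U₂ - U) * L₁ s + (U - U₁) * L₂ s) / (U₂ - U₁)))
    hC hF₁ (floor_on_cell_of_columnLaws t hn2'.le hn₂ hU₁ h12 hL₁ hL₂) hπ₁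
    (doccAnchor_on_cell t hΔ hU₁Δ h12 hn2' hn₂ hq hC₀ hC₁ hβh₂ hL₁ hL₂ hG₁ hG₂ hLG₁ hLG₂)
    ?_ hs hU h₁ h₂ hρ₁ hρ₁' hρ₂ hρ₂' hn0 hn2 hl0 hl1 hLs
  intro s hs U hU
  obtain ⟨hMnn, hM₀⟩ := doccAnchor_chord_slack (a := a) (b := b) (F := F₁ s) (L₁ := L₁ s) (L₂ := L₂ s) (c₀ := c₀ + cs * s) (c₁ := c₁) (k := 0) (β₀ := β₀)
    (βh₁ := βh₁) (βh₂ := βh₂) (π₁ := Q₁ s) (C₀ := C₀) (C₁ := C₁) (G₁ := G₁ s) (G₂ := G₂ s) h12 hU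
    (by have := hm₁ s hs; linarith) (by have := hm₂ s hs; linarith) (by have := hg₁ s hs; linarith) (by have := hg₂ s hs; linarith)
  have k := mul_le_mul_of_nonneg_right hβ₀ (by linarith [hMnn] :
    (0 : ℝ) ≤ a * F₁ s + b * (((U₂ - U) * L₁ s + (U - U₁) * L₂ s) / (U₂ - U₁)) - (c₀ + cs * s + c₁ * U))
  show a * Q₁ s + b * (C₀ + C₁ * (((U₂ - U) * L₁ s + (U - U₁) * L₂ s) / (U₂ - U₁) -
      ((U₂ - U) * G₁ s + (U - U₁) * G₂ s) / (U₂ - U₁)) - βh₂ * (((U₂ - U) * L₁ s + (U - U₁) * L₂ s) / (U₂ - U₁))) +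
      βh₁ * (a * F₁ s) + βh₂ * (b * (((U₂ - U) * L₁ s + (U - U₁) * L₂ s) / (U₂ - U₁))) <
    β * (a * F₁ s + b * (((U₂ - U) * L₁ s + (U - U₁) * L₂ s) / (U₂ - U₁)) - (c₀ + cs * s + c₁ * U))
  linarith

end Summit.Ventures.CertifiedManyBodySolver.Observables

end
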